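import Summits.CriticalPhenomena.SAWScalingLimit.Theorems.SAWRenewalTightnessRoomPassageEvents
import HarnessLib

/-!
# Guarded lattice room data: reduction of the (H2) layer of the line `room-entropy-wright-fisher`
to its deterministic Green and angle parts

Crux `SubseqIdentification` (stmt-CriticalPhenomena-0783), line `room-entropy-wright-fisher`,
reshape r7, stub `stub_latticeRoomDataNR` (the Kozdron–Lawler layer). This helper file

* defines the **guarded room-data bad event** `roomDataEventPos`: the registered event
  `roomDataEvent` with (i) the extra scope condition `0 < capTime` (a past of the walk whose
  polyline passes through the target point `b = D.pt 1` has a pulled-back trace through `∞`, no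
  hydrodynamic map, junk capacity `0` and a junk hull functional, while its Doob value is
  macroscopic — such pasts exist whenever a lattice edge of `Ω_δ` contains `b` in its interior,
  which happens along a sequence of meshes for suitable Jordan domains, and then, by a finite-energy
  argument, with non-vanishing probability; so they must be out of scope; at the first-passage
  indices used by the assembly the capacity is `≥ S₀ > 0` anyway) and (ii) the no-return side condition imposed on
  the WHOLE walk (as the assembly discharges it, from `noReturnEvent`), not only up to the past;
* defines the events of the three parts into which the guarded (H2) splits: `nearPastEvent` (a
  positive-capacity capped past comes close to `φ w` — deterministically empty for small `δ` by the
  height bound `(Im ζ)² ≤ 2 hcap` on the hull), `greenPartEvent` (the GREEN PART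
  `(π/2)(G_{Ω_δ}(z,z) − G_{Ω_δ∖η}(z,z)) ≈ log ψ^{K_η}(w)` fails at a guarded capped past) and
  `anglePartEvent` (the ANGLE PART `Λ(θ*_δ(η, z)) ≈ 3 H(S^{K_η}(ξ_η, w))` fails);
* proves the **combination lemma** `latticeRoomDataNR_of_parts` (registered sub-goal of the crux):
  the room–entropy law in slit domains (`RoomLawSlit`), the uniform integrability input
  (`RoomDeficitUI`) and the smallness in probability of the three part-events along `δ → 0⁺` imply
  the guarded form of `LatticeRoomDataNR` (union bound at tolerance `ε/4`).

The algebra: `roomDoob_n − N^{K}(ξ, w) = [(π/2)(G_∅ − G_η) − log ψ^K] + [Λ(θ*) − 3H(S^K)]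
− (π/2)·[condRoom_η − G_η + (2/π)Λ(θ*)]`, and the last bracket is what `RoomLawSlit` controls
outside an event of small probability.

References: G. F. Lawler, *Conformally Invariant Processes in the Plane* (2005), §3.4, §4.1;
M. Kozdron, G. Lawler, Electron. J. Probab. 10 (2005), Thm. 1.2; G. Lawler, O. Schramm,
W. Werner, Ann. Probab. 32 (2004), Prop. 2.2 / §5 (hitting probabilities in grid domains).
-/

noncomputable section

open MeasureTheory Filter Topology Set
open scoped NNReal ENNReal Classical BigOperators
open Literature.Probability.LatticeModels
open Literature.Probability.RandomPlanarGeometry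
open UpperHalfPlane (upperHalfPlaneSet)

namespace Summit.CriticalPhenomena.SAWScalingLimit.Theorems.SubseqIdentification.RoomEntropy

/-! ## The guarded room-data bad event -/

/-- **The guarded room-data bad event** at the lattice point `z` (near `φ w`), scales `R > r > 0`
and tolerance `ε`: at some past of POSITIVE capacity `≤ (Im w)²/16`, of a walk that never comes
back within `r` of `a` after having been at distance `≥ R` (whole-walk side condition), the exact
Doob martingale `roomDoob` misses the hull functional `hullRoomObs K_n ξ_n w` by more than `ε`.
[folklore] -/
def roomDataEventPos (D : DobrushinDomain) (φ : ConformalEquiv upperHalfPlaneSet D.carrier) (δ : ℝ)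
    (a b z : Site 2) (w : ℂ) (R r ε : ℝ) : Set (SAW.DomainSAW D.carrier δ a b) :=
  {γ | ∃ n : ℕ, 0 < LatticeSlit.capTime φ (prefixAt γ n) ∧
    LatticeSlit.capTime φ (prefixAt γ n) ≤ w.im ^ 2 / 16 ∧
    (∀ i k : ℕ, i < k → R ≤ dist (meshPoint δ (γ.walk.getVert i)) (D.pt 0) →
      r < dist (meshPoint δ (γ.walk.getVert k)) (D.pt 0)) ∧
    ε < |roomDoob D δ a b z γ n -
      hullRoomObs (LatticeSlit.pastHull φ (prefixAt γ n)) (LatticeSlit.drivingValue φ (prefixAt γ n)) w|}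

/-- The guarded event is contained in the registered one (it only adds scope conditions).
[folklore] -/
theorem roomDataEventPos_subset_roomDataEvent (D : DobrushinDomain)
    (φ : ConformalEquiv upperHalfPlaneSet D.carrier) (δ : ℝ) (a b z : Site 2) (w : ℂ) (R r ε : ℝ) :
    roomDataEventPos D φ δ a b z w R r ε ⊆ roomDataEvent D φ δ a b z w R r ε := by
  rintro γ ⟨n, -, hcap, hnr, hε⟩
  exact ⟨n, hcap, fun i k hik _ hR ↦ hnr i k hik hR, hε⟩

/-! ## Events of the three parts -/

/-- **The near-past event** at the observation point `φ w` and radius `ρ`: some past of positive capacity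
`≤ (Im w)²/16` has a vertex within `ρ` of `φ w`. (Deterministically empty for small `δ` and suitable
`ρ = ρ(w) > 0`: a vertex `v` gives a point `φ⁻¹(δ v)` of the hull, whence
`(Im φ⁻¹(δ v))² ≤ 2 hcap = 4 capTime ≤ (Im w)²/4` by Kemppainen–Smirnov's height bound
`IsBoundedHull.im_sq_le_two_mul_hcap`, while `φ⁻¹` maps a small ball around `φ w` above height `Im w/2`.)
[folklore] -/
def nearPastEvent (D : DobrushinDomain) (φ : ConformalEquiv upperHalfPlaneSet D.carrier) (δ : ℝ)
    (a b : Site 2) (w : ℂ) (ρ : ℝ) : Set (SAW.DomainSAW D.carrier δ a b) :=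
  {γ | ∃ n : ℕ, 0 < LatticeSlit.capTime φ (prefixAt γ n) ∧
    LatticeSlit.capTime φ (prefixAt γ n) ≤ w.im ^ 2 / 16 ∧
    ∃ v ∈ (prefixAt γ n).support, dist (meshPoint δ v) (φ w) < ρ}

/-- **The Green-part bad event**: at some guarded capped past `η = γ[0,n]` (`0 < capTime ≤ (Im w)²/16`,
whole-walk no return to `B(a, r)` after leaving `B(a, R)`), the lattice room deficit of the past
`(π/2)·[G_{Ω_δ}(z, z) − G_{Ω_δ∖η}(z, z)]` misses the log-conformal-radius loss `log ψ^{K_η}(w)` of the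
pulled-back hull by more than `ε` (Kozdron–Lawler's Theorem 1.2 twice — the potential-kernel constant
cancels — and the comparison of conformal-radius ratios control it). [folklore] -/
def greenPartEvent (D : DobrushinDomain) (φ : ConformalEquiv upperHalfPlaneSet D.carrier) (δ : ℝ)
    (a b z : Site 2) (w : ℂ) (R r ε : ℝ) : Set (SAW.DomainSAW D.carrier δ a b) :=
  {γ | ∃ n : ℕ, 0 < LatticeSlit.capTime φ (prefixAt γ n) ∧
    LatticeSlit.capTime φ (prefixAt γ n) ≤ w.im ^ 2 / 16 ∧
    (∀ i k : ℕ, i < k → R ≤ dist (meshPoint δ (γ.walk.getVert i)) (D.pt 0) →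
      r < dist (meshPoint δ (γ.walk.getVert k)) (D.pt 0)) ∧
    ε < |Real.pi / 2 * (roomAt D.carrier δ ∅ z - roomAt D.carrier δ (verts (prefixAt γ n)) z) -
      Real.log (hullDerivRatio (LatticeSlit.pastHull φ (prefixAt γ n)) w)|}

/-- **The angle-part bad event**: at some guarded capped past, the room profile at the lattice side
angle, `Λ(θ*_δ(η, z))`, misses `3·H(S^{K_η}(ξ_η, w))` by more than `ε` (discrete exit distribution
through the arc-`1` exits and the arc-`1`-side darts of the fattened slit against the harmonic measure
of the corresponding boundary arcs — Lawler–Schramm–Werner's hitting-probability estimate for grid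
domains; orientation-free since `Λ(θ) = Λ(π − θ)`). [folklore] -/
def anglePartEvent (D : DobrushinDomain) (φ : ConformalEquiv upperHalfPlaneSet D.carrier) (δ : ℝ)
    (a b z : Site 2) (w : ℂ) (R r ε : ℝ) : Set (SAW.DomainSAW D.carrier δ a b) :=
  {γ | ∃ n : ℕ, 0 < LatticeSlit.capTime φ (prefixAt γ n) ∧
    LatticeSlit.capTime φ (prefixAt γ n) ≤ w.im ^ 2 / 16 ∧
    (∀ i k : ℕ, i < k → R ≤ dist (meshPoint δ (γ.walk.getVert i)) (D.pt 0) →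
      r < dist (meshPoint δ (γ.walk.getVert k)) (D.pt 0)) ∧
    ε < |roomProfile (sideAngle D δ (prefixAt γ n) z (φ w)) -
      3 * Real.binEntropy (hullSchrammObs (LatticeSlit.pastHull φ (prefixAt γ n))
        (LatticeSlit.drivingValue φ (prefixAt γ n)) w)|}

/-! ## The combination lemma -/

/-- The algebra of the decomposition `roomDoob − N^K = Green part + angle part − (π/2)·law error`.
[folklore] -/
theorem roomDoob_sub_hullRoomObs_eq (G0 Gη C Λ ψ S : ℝ) :
    Real.pi / 2 * (G0 - C) - (Real.log ψ + 3 * Real.binEntropy S) =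
      (Real.pi / 2 * (G0 - Gη) - Real.log ψ) + (Λ - 3 * Real.binEntropy S) -
        Real.pi / 2 * (C - Gη + 2 / Real.pi * Λ) := by
  have hπ : Real.pi ≠ 0 := Real.pi_ne_zero
  field_simp
  ring

/-- Four quarters make an `ε` in `ℝ≥0∞`. [folklore] -/
theorem ofReal_quarter_four {ε : ℝ} (hε : 0 ≤ ε) :
    ENNReal.ofReal (ε / 4) + ENNReal.ofReal (ε / 4) + ENNReal.ofReal (ε / 4) + ENNReal.ofReal (ε / 4) =
      ENNReal.ofReal ε := by
  have h : 0 ≤ ε / 4 := by positivity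
  rw [← ENNReal.ofReal_add h h, ← ENNReal.ofReal_add (by positivity) h,
    ← ENNReal.ofReal_add (by positivity) h]
  congr 1
  ring

/-- Union bound over four events with a prescribed total. [folklore] -/
theorem measure_le_of_subset_union_four {Ω : Type*} [MeasurableSpace Ω] {μ : Measure Ω}
    {E A B C D : Set Ω} {a b c d t : ℝ≥0∞} (h : E ⊆ A ∪ B ∪ C ∪ D) (ha : μ A ≤ a) (hb : μ B ≤ b)
    (hc : μ C ≤ c) (hd : μ D ≤ d) (ht : a + b + c + d = t) : μ E ≤ t := by
  rw [← ht]
  calc μ E ≤ μ (A ∪ B ∪ C ∪ D) := measure_mono h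
    _ ≤ μ (A ∪ B ∪ C) + μ D := measure_union_le _ _
    _ ≤ μ (A ∪ B) + μ C + μ D := by gcongr; exact measure_union_le _ _
    _ ≤ μ A + μ B + μ C + μ D := by gcongr; exact measure_union_le _ _
    _ ≤ a + b + c + d := by gcongr

/-- **Combination lemma (guarded (H2) from its parts).** The room–entropy law in slit domains
(`RoomLawSlit`, first hypothesis), the uniform integrability of the terminal deficit (`RoomDeficitUI`,
second hypothesis), the smallness of the near-past events (`nearPastEvent`: positive-capacity capped
pasts stay away from `φ w`), of the Green-part bad events (`greenPartEvent`) and of the angle-part bad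
events (`anglePartEvent`) along `δ → 0⁺` imply the guarded lattice room data at `w ∈ ℍ` with lattice
points `z_δ → φ w`: the UI clause at `z = φ w` and, for every `ε`, a scale `R > 0` such that for all
`0 < r < R` and all small `δ`, the guarded room-data bad event `roomDataEventPos` has probability `≤ ε`
(the event is covered by the four bad events at tolerance `ε/4`). [folklore] -/
theorem latticeRoomDataNR_of_parts :
    (∀ (D : DobrushinDomain) (a b : ℝ → Site 2), SAW.IsEndpointApprox D a b →
      ∀ z ∈ D.carrier, ∀ (zδ : ℝ → Site 2),
        Tendsto (fun δ => meshPoint δ (zδ δ)) (𝓝[>] (0 : ℝ)) (𝓝 z) →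
      ∀ r ε : ℝ, 0 < r → 0 < ε →
      ∀ᶠ δ in 𝓝[>] (0 : ℝ),
        SAW.law D.carrier δ (a δ) (b δ)
            {γ | ∃ (w : Site 2) (hw : w ∈ γ.walk.support),
              (∀ v ∈ (γ.walk.takeUntil w hw).support, r ≤ dist (meshPoint δ v) z) ∧
              ε < |condRoom D.carrier δ (a δ) (b δ) (zδ δ) (γ.walk.takeUntil w hw)
                    - roomAt D.carrier δ (verts (γ.walk.takeUntil w hw)) (zδ δ)
                    + (2 / Real.pi) * roomProfile (sideAngle D δ (γ.walk.takeUntil w hw) (zδ δ) z)|}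
          ≤ ENNReal.ofReal ε) →
    (∀ (D : DobrushinDomain) (a b : ℝ → Site 2), SAW.IsEndpointApprox D a b →
      ∀ z ∈ D.carrier, ∀ (zδ : ℝ → Site 2),
        Tendsto (fun δ => meshPoint δ (zδ δ)) (𝓝[>] (0 : ℝ)) (𝓝 z) →
      ∀ ε : ℝ, 0 < ε → ∃ R : ℝ, ∀ᶠ δ in 𝓝[>] (0 : ℝ),
        ∫ γ in {γ : SAW.DomainSAW D.carrier δ (a δ) (b δ) |
                  R < roomAt D.carrier δ ∅ (zδ δ) - roomAt D.carrier δ (verts γ.walk) (zδ δ)},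
            (roomAt D.carrier δ ∅ (zδ δ) - roomAt D.carrier δ (verts γ.walk) (zδ δ))
          ∂(SAW.law D.carrier δ (a δ) (b δ)) ≤ ε) →
    (∀ (D : DobrushinDomain) (a b : ℝ → Site 2) (φ : ConformalEquiv upperHalfPlaneSet D.carrier),
      SAW.IsEndpointApprox D a b → D.IsChordalUniformizing φ →
      ∀ w : ℂ, 0 < w.im → ∃ ρ : ℝ, 0 < ρ ∧ ∀ ε : ℝ, 0 < ε → ∀ᶠ δ in 𝓝[>] (0 : ℝ),
        SAW.law D.carrier δ (a δ) (b δ) (nearPastEvent D φ δ (a δ) (b δ) w ρ) ≤ ENNReal.ofReal ε) →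
    (∀ (D : DobrushinDomain) (a b : ℝ → Site 2) (φ : ConformalEquiv upperHalfPlaneSet D.carrier),
      SAW.IsEndpointApprox D a b → D.IsChordalUniformizing φ →
      ∀ w : ℂ, 0 < w.im → ∀ (zδ : ℝ → Site 2),
        Tendsto (fun δ => meshPoint δ (zδ δ)) (𝓝[>] (0 : ℝ)) (𝓝 (φ w)) →
      ∀ ε : ℝ, 0 < ε → ∃ R : ℝ, 0 < R ∧ ∀ r : ℝ, 0 < r → r < R → ∀ᶠ δ in 𝓝[>] (0 : ℝ),
        SAW.law D.carrier δ (a δ) (b δ) (greenPartEvent D φ δ (a δ) (b δ) (zδ δ) w R r ε)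
          ≤ ENNReal.ofReal ε) →
    (∀ (D : DobrushinDomain) (a b : ℝ → Site 2) (φ : ConformalEquiv upperHalfPlaneSet D.carrier),
      SAW.IsEndpointApprox D a b → D.IsChordalUniformizing φ →
      ∀ w : ℂ, 0 < w.im → ∀ (zδ : ℝ → Site 2),
        Tendsto (fun δ => meshPoint δ (zδ δ)) (𝓝[>] (0 : ℝ)) (𝓝 (φ w)) →
      ∀ ε : ℝ, 0 < ε → ∃ R : ℝ, 0 < R ∧ ∀ r : ℝ, 0 < r → r < R → ∀ᶠ δ in 𝓝[>] (0 : ℝ),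
        SAW.law D.carrier δ (a δ) (b δ) (anglePartEvent D φ δ (a δ) (b δ) (zδ δ) w R r ε)
          ≤ ENNReal.ofReal ε) →
    ∀ (D : DobrushinDomain) (a b : ℝ → Site 2) (φ : ConformalEquiv upperHalfPlaneSet D.carrier),
      SAW.IsEndpointApprox D a b → D.IsChordalUniformizing φ →
      ∀ w : ℂ, 0 < w.im → ∀ (zδ : ℝ → Site 2),
        Tendsto (fun δ => meshPoint δ (zδ δ)) (𝓝[>] (0 : ℝ)) (𝓝 (φ w)) →
      (∀ ε : ℝ, 0 < ε → ∃ R : ℝ, ∀ᶠ δ in 𝓝[>] (0 : ℝ),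
        ∫ γ in {γ : SAW.DomainSAW D.carrier δ (a δ) (b δ) |
                  R < roomAt D.carrier δ ∅ (zδ δ) - roomAt D.carrier δ (verts γ.walk) (zδ δ)},
            (roomAt D.carrier δ ∅ (zδ δ) - roomAt D.carrier δ (verts γ.walk) (zδ δ))
          ∂(SAW.law D.carrier δ (a δ) (b δ)) ≤ ε) ∧
      ∀ ε : ℝ, 0 < ε → ∃ R : ℝ, 0 < R ∧ ∀ r : ℝ, 0 < r → r < R → ∀ᶠ δ in 𝓝[>] (0 : ℝ),
        SAW.law D.carrier δ (a δ) (b δ) (roomDataEventPos D φ δ (a δ) (b δ) (zδ δ) w R r ε)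
          ≤ ENNReal.ofReal ε := by
  intro hL hU hFar hG hA D a b φ hab hφ w hw zδ hz
  -- the observation point `φ w` is a point of the domain
  have hmem : φ w ∈ D.carrier := φ.mapsTo (show w ∈ upperHalfPlaneSet from hw)
  refine ⟨fun ε hε ↦ hU D a b hab (φ w) hmem zδ hz ε hε, fun ε hε ↦ ?_⟩
  have hε4 : 0 < ε / 4 := by positivity
  -- far-ness radius, law-in-slit-domains event, Green and angle scales
  obtain ⟨ρ, hρ, hfar⟩ := hFar D a b φ hab hφ w hw
  have hlaw := hL D a b hab (φ w) hmem zδ hz ρ (ε / 4) hρ hε4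
  obtain ⟨RG, hRG, hGr⟩ := hG D a b φ hab hφ w hw zδ hz (ε / 4) hε4
  obtain ⟨RA, hRA, hAr⟩ := hA D a b φ hab hφ w hw zδ hz (ε / 4) hε4
  refine ⟨min RG RA, lt_min hRG hRA, fun r hr hrR ↦ ?_⟩
  have hrG : r < RG := hrR.trans_le (min_le_left _ _)
  have hrA : r < RA := hrR.trans_le (min_le_right _ _)
  filter_upwards [hfar (ε / 4) hε4, hlaw, hGr r hr hrG, hAr r hr hrA] with δ h1 h2 h3 h4
  -- the guarded event is covered by the four bad events at tolerance `ε/4`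
  have hcover : roomDataEventPos D φ δ (a δ) (b δ) (zδ δ) w (min RG RA) r ε ⊆
      {γ | ∃ (w' : Site 2) (hw : w' ∈ γ.walk.support),
          (∀ v ∈ (γ.walk.takeUntil w' hw).support, ρ ≤ dist (meshPoint δ v) (φ w)) ∧
          ε / 4 < |condRoom D.carrier δ (a δ) (b δ) (zδ δ) (γ.walk.takeUntil w' hw)
                - roomAt D.carrier δ (verts (γ.walk.takeUntil w' hw)) (zδ δ)
                + (2 / Real.pi) * roomProfile (sideAngle D δ (γ.walk.takeUntil w' hw) (zδ δ) (φ w))|} ∪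
        nearPastEvent D φ δ (a δ) (b δ) w ρ ∪
        greenPartEvent D φ δ (a δ) (b δ) (zδ δ) w RG r (ε / 4) ∪
        anglePartEvent D φ δ (a δ) (b δ) (zδ δ) w RA r (ε / 4) := by
    rintro γ ⟨n, hpos, hcap, hnr, hbig⟩
    -- the no-return side condition at the two larger scales
    have hnrG : ∀ i k : ℕ, i < k → RG ≤ dist (meshPoint δ (γ.walk.getVert i)) (D.pt 0) →
        r < dist (meshPoint δ (γ.walk.getVert k)) (D.pt 0) :=
      fun i k hik hR ↦ hnr i k hik ((min_le_left _ _).trans hR)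
    have hnrA : ∀ i k : ℕ, i < k → RA ≤ dist (meshPoint δ (γ.walk.getVert i)) (D.pt 0) →
        r < dist (meshPoint δ (γ.walk.getVert k)) (D.pt 0) :=
      fun i k hik hR ↦ hnr i k hik ((min_le_right _ _).trans hR)
    by_cases hnear : ∃ v ∈ (prefixAt γ n).support, dist (meshPoint δ v) (φ w) < ρ
    · exact Or.inl (Or.inl (Or.inr ⟨n, hpos, hcap, hnear⟩))
    by_cases hGbad : ε / 4 < |Real.pi / 2 * (roomAt D.carrier δ ∅ (zδ δ) -
        roomAt D.carrier δ (verts (prefixAt γ n)) (zδ δ)) -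
          Real.log (hullDerivRatio (LatticeSlit.pastHull φ (prefixAt γ n)) w)|
    · exact Or.inl (Or.inr ⟨n, hpos, hcap, hnrG, hGbad⟩)
    by_cases hAbad : ε / 4 < |roomProfile (sideAngle D δ (prefixAt γ n) (zδ δ) (φ w)) -
        3 * Real.binEntropy (hullSchrammObs (LatticeSlit.pastHull φ (prefixAt γ n))
          (LatticeSlit.drivingValue φ (prefixAt γ n)) w)|
    · exact Or.inr ⟨n, hpos, hcap, hnrA, hAbad⟩
    refine Or.inl (Or.inl (Or.inl ⟨γ.walk.getVert n, γ.walk.getVert_mem_support n, ?_, ?_⟩))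
    · intro v hv
      by_contra hlt
      exact hnear ⟨v, hv, lt_of_not_ge hlt⟩
    have hGn := le_of_not_gt hGbad
    have hAn := le_of_not_gt hAbad
    -- the decomposition
    set G0 := roomAt D.carrier δ ∅ (zδ δ)
    set Gη := roomAt D.carrier δ (verts (prefixAt γ n)) (zδ δ)
    set C := condRoom D.carrier δ (a δ) (b δ) (zδ δ) (prefixAt γ n)
    set Λ := roomProfile (sideAngle D δ (prefixAt γ n) (zδ δ) (φ w))
    set ψ := hullDerivRatio (LatticeSlit.pastHull φ (prefixAt γ n)) w
    set S := hullSchrammObs (LatticeSlit.pastHull φ (prefixAt γ n))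
      (LatticeSlit.drivingValue φ (prefixAt γ n)) w
    have hdec : roomDoob D δ (a δ) (b δ) (zδ δ) γ n -
        hullRoomObs (LatticeSlit.pastHull φ (prefixAt γ n))
          (LatticeSlit.drivingValue φ (prefixAt γ n)) w =
        (Real.pi / 2 * (G0 - Gη) - Real.log ψ) + (Λ - 3 * Real.binEntropy S) -
          Real.pi / 2 * (C - Gη + 2 / Real.pi * Λ) :=
      roomDoob_sub_hullRoomObs_eq G0 Gη C Λ ψ S
    rw [hdec] at hbig
    -- if the law error were `≤ ε/4`, the total error would be `< ε`
    by_contra hsmall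
    have hsmall' : |C - Gη + 2 / Real.pi * Λ| ≤ ε / 4 := le_of_not_gt hsmall
    have hπ : Real.pi / 2 * |C - Gη + 2 / Real.pi * Λ| ≤ Real.pi / 2 * (ε / 4) :=
      mul_le_mul_of_nonneg_left hsmall' (by positivity)
    have hπ4 : Real.pi ≤ 4 := Real.pi_le_four
    have habs : |(Real.pi / 2 * (G0 - Gη) - Real.log ψ) + (Λ - 3 * Real.binEntropy S) -
        Real.pi / 2 * (C - Gη + 2 / Real.pi * Λ)| ≤
        ε / 4 + ε / 4 + Real.pi / 2 * (ε / 4) := by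
      refine (abs_sub _ _).trans (add_le_add ((abs_add_le _ _).trans (add_le_add hGn hAn)) ?_)
      rw [abs_mul, abs_of_pos (by positivity : (0 : ℝ) < Real.pi / 2)]
      exact hπ
    nlinarith [habs, hbig, hε]
  -- union bound
  exact measure_le_of_subset_union_four hcover h2 h1 h3 h4 (ofReal_quarter_four hε.le)

end Summit.CriticalPhenomena.SAWScalingLimit.Theorems.SubseqIdentification.RoomEntropy

end
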